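import Mathlib

/-!
# PneNP / ConvexRankGates — `ConvexGateBlind`: conic Carathéodory with few linear relations (support-canonical generators)

Helpers (`--supports stmt-PneNP-10680`), COLUMN-SPACE line (prover seat 2, session 23) — the linear-algebra engine of the
CODIMENSION theorem (`…Codimension.lean`): if a polynomial-size non-negative factorisation of the LP slice of the crux has
row objects spanning only `p` directions modulo the column space, it can be REWRITTEN as a restricted (column-space)
factorisation with at most `∑_{j ≤ p+1} C(R, j)` terms, which the column-space theorem forbids.

The engine, for vectors `y_l` (`l : ι`) in a real vector space such that every `p + 1` of them satisfy a non-trivial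
linear relation: the polyhedral cone `C = {a ≥ 0 : ∑_l a_l • y_l = 0}` is generated by CANONICAL generators `canonGen y T`
attached to SUPPORTS `T ⊆ ι` with `#T ≤ p + 1` — one generator per support, chosen before `a` is known
(`exists_conic_decomposition`). Proof: strong induction on the support of `a`; either some relation on the support is not
proportional to `a` (then `a` splits as a convex combination of two cone elements with smaller supports, by the ratio /
first-exit lemmas `exists_mixed_sign_of_not_smul`, `exists_sub_smul_support_ssubset`), or every relation on the support
is proportional to `a` (then the support is irreducible, `a` is a positive multiple of the canonical generator, and the
support has at most `p + 1` elements because `p + 1` of its indices already carry a relation). [folklore]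
-/

set_option linter.dupNamespace false

namespace Summit.PneNP.PneNP.Theorems

open Finset

noncomputable section

namespace ConicSupport

variable {ι : Type} [Fintype ι] {M : Type} [AddCommGroup M] [Module ℝ M]

/-- The relations on a support `T`: coefficient vectors vanishing off `T` that annihilate `y`. [folklore] -/
def relOn (y : ι → M) (T : Finset ι) : Set (ι → ℝ) :=
  {h | (∀ l, l ∉ T → h l = 0) ∧ ∑ l, h l • y l = 0}

/-- The canonical generator attached to a support `T`: if `T` is IRREDUCIBLE for `y` — some non-zero non-negative
relation on `T` spans all relations on `T` — a chosen such relation; otherwise `0`. [folklore] -/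
def canonGen (y : ι → M) (T : Finset ι) : ι → ℝ :=
  @dite _ (∃ g : ι → ℝ, g ∈ relOn y T ∧ (∀ l, 0 ≤ g l) ∧ g ≠ 0 ∧ ∀ h ∈ relOn y T, ∃ c : ℝ, h = c • g)
    (Classical.dec _) (fun hT => Classical.choose hT) (fun _ => 0)

/-- Defining property of the canonical generator of an irreducible support. [folklore] -/
theorem canonGen_spec (y : ι → M) {T : Finset ι}
    (hT : ∃ g : ι → ℝ, g ∈ relOn y T ∧ (∀ l, 0 ≤ g l) ∧ g ≠ 0 ∧ ∀ h ∈ relOn y T, ∃ c : ℝ, h = c • g) :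
    canonGen y T ∈ relOn y T ∧ (∀ l, 0 ≤ canonGen y T l) ∧ canonGen y T ≠ 0 ∧
      ∀ h ∈ relOn y T, ∃ c : ℝ, h = c • canonGen y T := by
  rw [canonGen, dif_pos hT]
  exact Classical.choose_spec hT

/-- Off irreducible supports the canonical generator is `0`. [folklore] -/
theorem canonGen_of_not (y : ι → M) {T : Finset ι}
    (hT : ¬ ∃ g : ι → ℝ, g ∈ relOn y T ∧ (∀ l, 0 ≤ g l) ∧ g ≠ 0 ∧ ∀ h ∈ relOn y T, ∃ c : ℝ, h = c • g) :
    canonGen y T = 0 := by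
  rw [canonGen, dif_neg hT]

/-- The canonical generator is non-negative. [folklore] -/
theorem canonGen_nonneg (y : ι → M) (T : Finset ι) (l : ι) : 0 ≤ canonGen y T l := by
  by_cases hT : ∃ g : ι → ℝ, g ∈ relOn y T ∧ (∀ l, 0 ≤ g l) ∧ g ≠ 0 ∧ ∀ h ∈ relOn y T, ∃ c : ℝ, h = c • g
  · exact (canonGen_spec y hT).2.1 l
  · rw [canonGen_of_not y hT]; exact le_rfl

/-- The canonical generator vanishes off its support. [folklore] -/
theorem canonGen_eq_zero (y : ι → M) (T : Finset ι) {l : ι} (hl : l ∉ T) : canonGen y T l = 0 := by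
  by_cases hT : ∃ g : ι → ℝ, g ∈ relOn y T ∧ (∀ l, 0 ≤ g l) ∧ g ≠ 0 ∧ ∀ h ∈ relOn y T, ∃ c : ℝ, h = c • g
  · exact (canonGen_spec y hT).1.1 l hl
  · rw [canonGen_of_not y hT]; rfl

/-- The canonical generator is a relation. [folklore] -/
theorem sum_canonGen_smul (y : ι → M) (T : Finset ι) : ∑ l, canonGen y T l • y l = 0 := by
  by_cases hT : ∃ g : ι → ℝ, g ∈ relOn y T ∧ (∀ l, 0 ≤ g l) ∧ g ≠ 0 ∧ ∀ h ∈ relOn y T, ∃ c : ℝ, h = c • g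
  · exact (canonGen_spec y hT).1.2
  · simp [canonGen_of_not y hT]

/-- **Ratio lemma.** If `a ≥ 0`, `h` vanishes wherever `a` does, and `h` is not a multiple of `a`, then some shift
`h − σ•a` has a strictly positive and a strictly negative coordinate. [folklore] -/
theorem exists_mixed_sign_of_not_smul (a h : ι → ℝ) (ha : ∀ l, 0 ≤ a l) (hh : ∀ l, a l = 0 → h l = 0)
    (hnot : ¬ ∃ c : ℝ, h = c • a) :
    ∃ σ : ℝ, (∃ l, 0 < h l - σ * a l) ∧ (∃ l, h l - σ * a l < 0) := by
  set T : Finset ι := Finset.univ.filter fun l => a l ≠ 0 with hT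
  have hTne : T.Nonempty := by
    by_contra hem
    rw [Finset.not_nonempty_iff_eq_empty] at hem
    apply hnot
    refine ⟨0, funext fun l => ?_⟩
    have hl : a l = 0 := by
      by_contra hne
      have : l ∈ T := Finset.mem_filter.2 ⟨Finset.mem_univ _, hne⟩
      rw [hem] at this
      exact absurd this (Finset.notMem_empty _)
    rw [Pi.smul_apply, smul_eq_mul, zero_mul]
    exact hh l hl
  set r : ι → ℝ := fun l => h l / a l with hr
  have hmul : ∀ l ∈ T, h l = a l * r l := by
    intro l hl
    have hne : a l ≠ 0 := (Finset.mem_filter.1 hl).2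
    rw [hr]; field_simp
  obtain ⟨l₁, hl₁, hmin⟩ := Finset.exists_min_image T r hTne
  obtain ⟨l₂, hl₂, hmax⟩ := Finset.exists_max_image T r hTne
  by_cases heq : r l₁ = r l₂
  · exfalso
    apply hnot
    refine ⟨r l₁, funext fun l => ?_⟩
    rw [Pi.smul_apply, smul_eq_mul]
    by_cases hl : l ∈ T
    · rw [hmul l hl, mul_comm]
      congr 1
      exact le_antisymm (heq ▸ hmax l hl) (hmin l hl)
    · have hal : a l = 0 := by
        by_contra hne
        exact hl (Finset.mem_filter.2 ⟨Finset.mem_univ _, hne⟩)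
      rw [hh l hal, hal, mul_zero]
  · have hlt : r l₁ < r l₂ := lt_of_le_of_ne (hmin l₂ hl₂) heq
    have ha1 : 0 < a l₁ := lt_of_le_of_ne (ha l₁) (Ne.symm (Finset.mem_filter.1 hl₁).2)
    have ha2 : 0 < a l₂ := lt_of_le_of_ne (ha l₂) (Ne.symm (Finset.mem_filter.1 hl₂).2)
    refine ⟨(r l₁ + r l₂) / 2, ⟨l₂, ?_⟩, ⟨l₁, ?_⟩⟩
    · rw [hmul l₂ hl₂]
      have : 0 < a l₂ * (r l₂ - (r l₁ + r l₂) / 2) := mul_pos ha2 (by linarith)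
      linarith [this]
    · rw [hmul l₁ hl₁]
      have : 0 < a l₁ * ((r l₁ + r l₂) / 2 - r l₁) := mul_pos ha1 (by linarith)
      linarith [this]

/-- **First-exit lemma.** If `a ≥ 0`, `h` vanishes wherever `a` does and `h` has a strictly positive coordinate, then for
some `t > 0` the vector `a − t•h` is still non-negative and has strictly smaller support than `a`. [folklore] -/
theorem exists_sub_smul_support_ssubset (a h : ι → ℝ) (ha : ∀ l, 0 ≤ a l) (hh : ∀ l, a l = 0 → h l = 0)
    (hpos : ∃ l, 0 < h l) :
    ∃ t : ℝ, 0 < t ∧ (∀ l, 0 ≤ a l - t * h l) ∧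
      (Finset.univ.filter fun l => a l - t * h l ≠ 0) ⊂ (Finset.univ.filter fun l => a l ≠ 0) := by
  set P : Finset ι := Finset.univ.filter fun l => 0 < h l with hP
  have hPne : P.Nonempty := by
    obtain ⟨l, hl⟩ := hpos
    exact ⟨l, Finset.mem_filter.2 ⟨Finset.mem_univ _, hl⟩⟩
  obtain ⟨l₀, hl₀, hmin⟩ := Finset.exists_min_image P (fun l => a l / h l) hPne
  have hh0 : 0 < h l₀ := (Finset.mem_filter.1 hl₀).2
  have ha0 : 0 < a l₀ := by
    refine lt_of_le_of_ne (ha l₀) fun h0 => ?_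
    have := hh l₀ h0.symm
    linarith
  set t : ℝ := a l₀ / h l₀ with ht
  have htpos : 0 < t := div_pos ha0 hh0
  refine ⟨t, htpos, fun l => ?_, ?_⟩
  · by_cases hl : 0 < h l
    · have hle : t ≤ a l / h l := hmin l (Finset.mem_filter.2 ⟨Finset.mem_univ _, hl⟩)
      rw [le_div_iff₀ hl] at hle
      linarith
    · push Not at hl
      nlinarith [ha l]
  · rw [Finset.ssubset_iff_of_subset]
    · refine ⟨l₀, Finset.mem_filter.2 ⟨Finset.mem_univ _, ha0.ne'⟩, fun hmem => ?_⟩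
      have hne := (Finset.mem_filter.1 hmem).2
      apply hne
      rw [ht, div_mul_cancel₀ _ hh0.ne', sub_self]
    · intro l hl
      rw [Finset.mem_filter] at hl ⊢
      refine ⟨hl.1, fun h0 => hl.2 ?_⟩
      rw [h0, hh l h0, mul_zero, sub_zero]

/-- **Conic Carathéodory with `p` relations (support-canonical form).** If every `p + 1` of the vectors `y_l` carry a
non-trivial linear relation, then every non-negative relation `a` (`a ≥ 0`, `∑ a_l • y_l = 0`) is a non-negative
combination of the canonical generators of supports of size `≤ p + 1`. [folklore] -/
theorem exists_conic_decomposition (y : ι → M) (p : ℕ)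
    (hp : ∀ s : Finset ι, s.card = p + 1 → ∃ h : ι → ℝ, (∀ l, l ∉ s → h l = 0) ∧ h ≠ 0 ∧ ∑ l, h l • y l = 0)
    (a : ι → ℝ) (ha : ∀ l, 0 ≤ a l) (hay : ∑ l, a l • y l = 0) :
    ∃ lam : Finset ι → ℝ, (∀ T, 0 ≤ lam T) ∧ (∀ T, p + 1 < T.card → lam T = 0) ∧
      ∀ l, a l = ∑ T, lam T * canonGen y T l := by
  -- strong induction on the size of the support
  suffices H : ∀ (n : ℕ) (a : ι → ℝ), (Finset.univ.filter fun l => a l ≠ 0).card = n → (∀ l, 0 ≤ a l) →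
      ∑ l, a l • y l = 0 → ∃ lam : Finset ι → ℝ, (∀ T, 0 ≤ lam T) ∧ (∀ T, p + 1 < T.card → lam T = 0) ∧
        ∀ l, a l = ∑ T, lam T * canonGen y T l from H _ a rfl ha hay
  intro n
  induction n using Nat.strong_induction_on with
  | _ n ih =>
    intro a hcard ha hay
    set T : Finset ι := Finset.univ.filter fun l => a l ≠ 0 with hT
    have hmemT : ∀ l, l ∈ T ↔ a l ≠ 0 := fun l => by simp [hT]
    -- trivial case `a = 0`
    by_cases hzero : a = 0
    · refine ⟨0, fun _ => le_rfl, fun _ _ => rfl, fun l => ?_⟩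
      simp [hzero]
    have hTne : T.Nonempty := by
      by_contra hem
      rw [Finset.not_nonempty_iff_eq_empty] at hem
      apply hzero
      funext l
      by_contra hne
      have : l ∈ T := (hmemT l).2 hne
      rw [hem] at this
      exact absurd this (Finset.notMem_empty _)
    have haT : a ∈ relOn y T := ⟨fun l hl => by simpa [hmemT] using hl, hay⟩
    by_cases hA : ∃ h, h ∈ relOn y T ∧ ¬ ∃ c : ℝ, h = c • a
    · -- Case A: a relation on the support not proportional to `a` — split `a`
      obtain ⟨h, hrel, hnot⟩ := hA
      have hh : ∀ l, a l = 0 → h l = 0 := fun l hl => hrel.1 l (by simpa [hmemT] using hl)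
      obtain ⟨σ, ⟨lp, hlp⟩, ⟨ln, hln⟩⟩ := exists_mixed_sign_of_not_smul a h ha hh hnot
      set h' : ι → ℝ := fun l => h l - σ * a l with hh'
      have hh'0 : ∀ l, a l = 0 → h' l = 0 := fun l hl => by simp only [hh', hh l hl, hl, mul_zero, sub_zero]
      have hh'y : ∑ l, h' l • y l = 0 := by
        simp only [hh', sub_smul, Finset.sum_sub_distrib, mul_smul, ← Finset.smul_sum, hay, hrel.2, smul_zero,
          sub_zero]
      -- exit along `h'`
      obtain ⟨t₀, ht₀, ha₀, hss₀⟩ := exists_sub_smul_support_ssubset a h' ha hh'0 ⟨lp, hlp⟩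
      -- exit along `-h'`
      obtain ⟨t₁, ht₁, ha₁, hss₁⟩ := exists_sub_smul_support_ssubset a (fun l => - h' l) ha
        (fun l hl => by simp only [hh'0 l hl, neg_zero]) ⟨ln, by linarith⟩
      set a₀ : ι → ℝ := fun l => a l - t₀ * h' l with ha₀def
      set a₁ : ι → ℝ := fun l => a l - t₁ * (- h' l) with ha₁def
      have hc₀ : (Finset.univ.filter fun l => a₀ l ≠ 0).card < n := hcard ▸ Finset.card_lt_card hss₀
      have hc₁ : (Finset.univ.filter fun l => a₁ l ≠ 0).card < n := hcard ▸ Finset.card_lt_card hss₁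
      have hay₀ : ∑ l, a₀ l • y l = 0 := by
        simp only [ha₀def, sub_smul, Finset.sum_sub_distrib, mul_smul, ← Finset.smul_sum, hay, hh'y, smul_zero,
          sub_zero]
      have hay₁ : ∑ l, a₁ l • y l = 0 := by
        simp only [ha₁def, mul_neg, sub_neg_eq_add, add_smul, Finset.sum_add_distrib, mul_smul, ← Finset.smul_sum,
          hay, hh'y, smul_zero, add_zero]
      obtain ⟨lam₀, hlam₀, hbig₀, hdec₀⟩ := ih _ hc₀ a₀ rfl ha₀ hay₀
      obtain ⟨lam₁, hlam₁, hbig₁, hdec₁⟩ := ih _ hc₁ a₁ rfl ha₁ hay₁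
      have hsum : 0 < t₀ + t₁ := by linarith
      refine ⟨fun T => t₁ / (t₀ + t₁) * lam₀ T + t₀ / (t₀ + t₁) * lam₁ T, fun T => ?_, fun T hT => ?_, fun l => ?_⟩
      · have := hlam₀ T; have := hlam₁ T; positivity
      · dsimp only
        rw [hbig₀ T hT, hbig₁ T hT]; ring
      · have h0 := hdec₀ l
        have h1 := hdec₁ l
        simp only [ha₀def, ha₁def] at h0 h1
        have hl : a l = t₁ / (t₀ + t₁) * (a l - t₀ * h' l) + t₀ / (t₀ + t₁) * (a l - t₁ * -h' l) := by
          field_simp; ring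
        rw [hl, h0, h1, Finset.mul_sum, Finset.mul_sum, ← Finset.sum_add_distrib]
        exact Finset.sum_congr rfl fun T _ => by ring
    · -- Case B: every relation on the support is proportional to `a` — the support is irreducible
      push Not at hA
      obtain ⟨hgrel, hg0, hgne, hgspan⟩ := canonGen_spec y ⟨a, haT, ha, hzero, fun h hh => hA h hh⟩
      obtain ⟨c, hc⟩ := hgspan a haT
      -- `c ≥ 0`
      have hcnn : 0 ≤ c := by
        obtain ⟨l, hl⟩ : ∃ l, canonGen y T l ≠ 0 := by
          by_contra hall
          push Not at hall
          exact hgne (funext hall)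
        have hgl : 0 < canonGen y T l := lt_of_le_of_ne (hg0 l) (Ne.symm hl)
        have hal : a l = c * canonGen y T l := by rw [hc]; rfl
        nlinarith [ha l]
      -- `#T ≤ p + 1`
      have hTcard : T.card ≤ p + 1 := by
        by_contra hlt
        push Not at hlt
        obtain ⟨s, hsT, hscard⟩ := Finset.exists_subset_card_eq (show p + 1 ≤ T.card by omega)
        obtain ⟨h, hhs, hhne, hhy⟩ := hp s hscard
        have hrelh : h ∈ relOn y T := ⟨fun l hl => hhs l fun hls => hl (hsT hls), hhy⟩
        obtain ⟨c', hc'⟩ := hA h hrelh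
        -- an index of `T` outside `s`
        obtain ⟨l, hlT, hls⟩ : ∃ l ∈ T, l ∉ s := by
          by_contra hall
          push Not at hall
          have : T ⊆ s := hall
          have := Finset.card_le_card this
          omega
        have hal : a l ≠ 0 := (hmemT l).1 hlT
        have hhl : h l = 0 := hhs l hls
        have hc'0 : c' = 0 := by
          have : h l = c' * a l := by rw [hc']; rfl
          rw [hhl] at this
          rcases mul_eq_zero.1 this.symm with h1 | h1
          · exact h1
          · exact absurd h1 hal
        apply hhne
        rw [hc', hc'0, zero_smul]
      classical
      refine ⟨fun T' => if T' = T then c else 0, fun T' => ?_, fun T' hT' => ?_, fun l => ?_⟩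
      · dsimp only
        split_ifs
        · exact hcnn
        · exact le_rfl
      · dsimp only
        rw [if_neg]
        rintro rfl
        omega
      · simp only [ite_mul, zero_mul, Finset.sum_ite_eq', Finset.mem_univ, if_true]
        rw [hc]; rfl

end ConicSupport

/-- **Conic Carathéodory with `p` relations** (registered form of `ConicSupport.exists_conic_decomposition`). [folklore] -/
theorem conic_decomposition : ∀ {ι : Type} [Fintype ι] {M : Type} [AddCommGroup M] [Module ℝ M] (y : ι → M) (p : ℕ), (∀ s : Finset ι, s.card = p + 1 → ∃ h : ι → ℝ, (∀ l, l ∉ s → h l = 0) ∧ h ≠ 0 ∧ ∑ l, h l • y l = 0) → ∀ (a : ι → ℝ), (∀ l, 0 ≤ a l) → ∑ l, a l • y l = 0 → ∃ lam : Finset ι → ℝ, (∀ T, 0 ≤ lam T) ∧ (∀ T, p + 1 < T.card → lam T = 0) ∧ ∀ l, a l = ∑ T, lam T * ConicSupport.canonGen y T l :=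
  fun y p hp a ha hay => ConicSupport.exists_conic_decomposition y p hp a ha hay

end

end Summit.PneNP.PneNP.Theorems
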